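import Mathlib
import Literature.NumberTheory.EllipticCurves.ThreeIsogeny
import Literature.NumberTheory.EllipticCurves.MordellCurvePhiDescentHom
import Literature.NumberTheory.EllipticCurves.KramerTwoDescentValuation

/-!
# Rank-2 observatory, KERNEL-3ISO (A4): the `E`-side support law — `α(P)` is supported on the primes of `2s`

HONEST FRAMING: per-curve certified theorems and census instruments; no claim on BSD in rank ≥ 2.

Cell `bsd-rank2-observatory`, cert-1 leg KERNEL-3ISO. For `E = E_{m,s} : y² = x³ + (mx + s)²` with
`m, s ∈ ℤ` and the `3`-descent values `α(x, y) = y - (mx + s)` (off `T`), `α(T) = (2s)²`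
(Cohen GTM 239 Def. 8.4.7; Cohen–Pazuki Def. 1.3), elementary `p`-adic bookkeeping on
`(y - (mx + s))(y + (mx + s)) = x³`, `(y + (mx + s)) - (y - (mx + s)) = 2(mx + s)` gives:

* `three_dvd_padicValRat_descent`: for every prime `p ∤ 2s`, `3 ∣ v_p(y - (mx + s))` (Cohen–Pazuki
  Thm. 3.1 (3): `u₁u₂ ∣ 2b`; Silverman *AEC* X.4.9-type unramifiedness outside the bad primes);
* `exists_pow_three_of_padicValRat`: a non-zero rational all of whose valuations are multiples of `3`
  is a cube (unique factorisation; `-1 = (-1)³`);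
* `cubeClass_eq_prod_primeFactors`: hence the class of such a value modulo cubes is that of
  `∏_{p ∣ N} p^{e_p}` with `0 ≤ e_p ≤ 2`, `N = |2s|`;
* **`descent_value_mem`**: for any additive `κ` with the descent values, every `κ(P)` is
  `[∏_{p ∣ 2s} p^{e_p}]` for some exponent vector `e < 3` — the finite set `S₁ ⊇ Im α` of the index bound
  `ThreeIso.three_pow_mordellWeilRank_succ_le_of_zsmul` before local sieving.

References: [CohenPazuki2009] H. Cohen, F. Pazuki, *Elementary 3-descent with a 3-isogeny*, Acta Arith.
140 (2009), Thm. 3.1; [Cohen2007NumberTheoryI] GTM 239, §8.4.4; Silverman *AEC* X.4.9.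
-/

noncomputable section

set_option linter.dupNamespace false

open scoped Classical

open WeierstrassCurve

namespace Summit.BirchSwinnertonDyer.BirchSwinnertonDyer.Rank2Observatory.ThreeIso

open Literature.NumberTheory.EllipticCurves Literature.NumberTheory.EllipticCurves.MordellDescent
  Literature.NumberTheory.EllipticCurves.KramerTwoDescent

/-! ### Rationals with valuations in `3ℤ` are cubes -/

/-- A non-zero natural number all of whose prime exponents are multiples of `3` is a cube. [folklore] -/
theorem nat_exists_pow_three {n : ℕ} (hn : n ≠ 0) (h : ∀ p : ℕ, p.Prime → 3 ∣ padicValNat p n) :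
    ∃ k : ℕ, n = k ^ 3 := by
  refine ⟨n.factorization.prod fun p e => p ^ (e / 3), ?_⟩
  rw [Finsupp.prod, ← Finset.prod_pow]
  conv_lhs => rw [← Nat.prod_factorization_pow_eq_self hn, Finsupp.prod]
  refine Finset.prod_congr rfl fun p hp => ?_
  rw [← pow_mul]
  congr 1
  have hp' : p.Prime := Nat.prime_of_mem_primeFactors (by simpa using hp)
  have h3 := h p hp'
  rw [← Nat.factorization_def n hp'] at h3
  omega

/-- **A non-zero rational all of whose `p`-adic valuations are multiples of `3` is a cube.** [folklore] -/
theorem exists_pow_three_of_padicValRat {a : ℚ} (ha : a ≠ 0)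
    (h : ∀ p : ℕ, p.Prime → (3 : ℤ) ∣ padicValRat p a) : ∃ r : ℚ, a = r ^ 3 := by
  have hnum : a.num ≠ 0 := Rat.num_ne_zero.mpr ha
  have hcop : a.num.natAbs.Coprime a.den := a.reduced
  have key : ∀ p : ℕ, p.Prime → 3 ∣ padicValNat p a.num.natAbs ∧ 3 ∣ padicValNat p a.den := by
    intro p hp
    have hv : padicValRat p a = (padicValNat p a.num.natAbs : ℤ) - (padicValNat p a.den : ℤ) := by
      rw [padicValRat_def]; rfl
    have hev := h p hp
    rw [hv] at hev
    have hnot : ¬ (p ∣ a.num.natAbs ∧ p ∣ a.den) := fun ⟨h1, h2⟩ =>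
      hp.ne_one (Nat.eq_one_of_dvd_coprimes hcop h1 h2)
    by_cases h1 : p ∣ a.num.natAbs
    · have h2 : padicValNat p a.den = 0 := padicValNat.eq_zero_of_not_dvd fun h2 => hnot ⟨h1, h2⟩
      rw [h2] at hev ⊢
      refine ⟨?_, dvd_zero 3⟩
      obtain ⟨k, hk⟩ := hev
      exact ⟨k.toNat, by omega⟩
    · have h1' : padicValNat p a.num.natAbs = 0 := padicValNat.eq_zero_of_not_dvd h1
      rw [h1'] at hev ⊢
      refine ⟨dvd_zero 3, ?_⟩
      obtain ⟨k, hk⟩ := hev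
      exact ⟨(-k).toNat, by omega⟩
  obtain ⟨k, hk⟩ := nat_exists_pow_three (Int.natAbs_ne_zero.mpr hnum) fun p hp => (key p hp).1
  obtain ⟨l, hl⟩ := nat_exists_pow_three a.den_pos.ne' fun p hp => (key p hp).2
  rcases lt_or_gt_of_ne hnum with hneg | hpos
  · refine ⟨-(k : ℚ) / l, ?_⟩
    have hnumk : (a.num : ℚ) = -(k : ℚ) ^ 3 := by
      have : a.num = -(a.num.natAbs : ℤ) := by omega
      rw [this, hk]; push_cast; ring
    have hdenl : (a.den : ℚ) = (l : ℚ) ^ 3 := by rw [hl]; push_cast; ring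
    rw [← Rat.num_div_den a, hnumk, hdenl, div_pow]; ring
  · refine ⟨(k : ℚ) / l, ?_⟩
    have hnumk : (a.num : ℚ) = (k : ℚ) ^ 3 := by
      have : a.num = (a.num.natAbs : ℤ) := by omega
      rw [this, hk]; push_cast; ring
    have hdenl : (a.den : ℚ) = (l : ℚ) ^ 3 := by rw [hl]; push_cast; ring
    rw [← Rat.num_div_den a, hnumk, hdenl, div_pow]

/-! ### Valuation of a product of prime powers -/

/-- `v_p(∏_{q ∈ S} q^{e_q}) = e_p` if `p ∈ S`, else `0` (`S` a set of primes). [folklore] -/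
theorem padicValRat_prod_prime_pow {S : Finset ℕ} (hS : ∀ q ∈ S, q.Prime) (e : ℕ → ℕ) (p : ℕ)
    [hp : Fact p.Prime] :
    padicValRat p (∏ q ∈ S, (q : ℚ) ^ e q) = if p ∈ S then (e p : ℤ) else 0 := by
  induction S using Finset.induction_on with
  | empty => simp
  | @insert q S hq ih =>
    have hqP : q.Prime := hS q (Finset.mem_insert_self q S)
    have hS' : ∀ r ∈ S, r.Prime := fun r hr => hS r (Finset.mem_insert_of_mem hr)
    have hq0 : (q : ℚ) ^ e q ≠ 0 := pow_ne_zero _ (Nat.cast_ne_zero.mpr hqP.ne_zero)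
    have hprod0 : ∏ r ∈ S, (r : ℚ) ^ e r ≠ 0 :=
      Finset.prod_ne_zero_iff.mpr fun r hr => pow_ne_zero _ (Nat.cast_ne_zero.mpr (hS' r hr).ne_zero)
    rw [Finset.prod_insert hq, padicValRat.mul hq0 hprod0, ih hS', padicValRat.pow]
    by_cases hpq : p = q
    · subst hpq
      rw [if_neg hq, padicValRat.self hp.out.one_lt, if_pos (Finset.mem_insert_self p S)]; simp
    · haveI : Fact q.Prime := ⟨hqP⟩
      have : padicValRat p (q : ℚ) = 0 := by
        rw [padicValRat.of_nat, Nat.cast_eq_zero, padicValNat_primes hpq]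
      rw [this, mul_zero, zero_add]
      by_cases hpS : p ∈ S
      · rw [if_pos hpS, if_pos (Finset.mem_insert_of_mem hpS)]
      · rw [if_neg hpS, if_neg (by simp [hpq, hpS])]

/-- The prime-power product is non-zero. [folklore] -/
theorem prod_prime_pow_ne_zero {S : Finset ℕ} (hS : ∀ q ∈ S, q.Prime) (e : ℕ → ℕ) :
    ∏ q ∈ S, (q : ℚ) ^ e q ≠ 0 :=
  Finset.prod_ne_zero_iff.mpr fun r hr => pow_ne_zero _ (Nat.cast_ne_zero.mpr (hS r hr).ne_zero)

/-- **Cube classes supported on the primes of `N`**: if `w ≠ 0` has `3 ∣ v_p(w)` for every prime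
`p ∤ N` (`N ≠ 0`), then `[w] = [∏_{p ∣ N} p^{e_p}]` in `ℚ*/ℚ*³` with `e_p = v_p(w) mod 3 ∈ {0, 1, 2}`.
[folklore] -/
theorem cubeClass_eq_prod_primeFactors {w : ℚ} (hw : w ≠ 0) {N : ℕ} (hN : N ≠ 0)
    (h : ∀ p : ℕ, p.Prime → ¬ p ∣ N → (3 : ℤ) ∣ padicValRat p w) :
    ∃ e : ℕ → ℕ, (∀ p, e p < 3) ∧
      cubeClass w = cubeClass (∏ p ∈ N.primeFactors, (p : ℚ) ^ e p) := by
  set e : ℕ → ℕ := fun p => ((padicValRat p w) % 3).toNat with he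
  have he3 : ∀ p, e p < 3 := fun p => by
    have h0 : 0 ≤ padicValRat p w % 3 := Int.emod_nonneg _ (by norm_num)
    have h1 : padicValRat p w % 3 < 3 := Int.emod_lt_of_pos _ (by norm_num)
    simp only [he]; omega
  refine ⟨e, he3, ?_⟩
  have hS : ∀ q ∈ N.primeFactors, q.Prime := fun q hq => Nat.prime_of_mem_primeFactors hq
  have hu0 := prod_prime_pow_ne_zero hS e
  rw [cubeClass_eq_cubeClass_iff hw hu0]
  -- `w / u` has all valuations in `3ℤ`
  have hval : ∀ p : ℕ, p.Prime → (3 : ℤ) ∣ padicValRat p (w / ∏ q ∈ N.primeFactors, (q : ℚ) ^ e q) := by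
    intro p hp
    haveI : Fact p.Prime := ⟨hp⟩
    rw [padicValRat.div hw hu0, padicValRat_prod_prime_pow hS e p]
    by_cases hpN : p ∣ N
    · rw [if_pos (Nat.mem_primeFactors.mpr ⟨hp, hpN, hN⟩)]
      simp only [he]
      have h0 : 0 ≤ padicValRat p w % 3 := Int.emod_nonneg _ (by norm_num)
      rw [Int.toNat_of_nonneg h0]
      exact ⟨padicValRat p w / 3, by omega⟩
    · rw [if_neg (fun hm => hpN (Nat.dvd_of_mem_primeFactors hm)), sub_zero]
      exact h p hp hpN
  obtain ⟨r, hr⟩ := exists_pow_three_of_padicValRat (div_ne_zero hw hu0) hval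
  refine ⟨r, fun hr0 => ?_, ?_⟩
  · rw [hr0, zero_pow three_ne_zero, div_eq_zero_iff] at hr
    exact hr.elim hw hu0
  · rw [← hr, mul_div_cancel₀ _ hu0]

/-! ### The valuation of the descent values at primes `p ∤ 2s` -/

section Valuation

variable {p : ℕ} [Fact p.Prime]

/-- On `y² = x³ + (mx + s)²` with `m, s ∈ ℤ`: if `v_p(x) < 0` then `y ≠ 0` and `2 v_p(y) = 3 v_p(x)`
(the classical `x = a/d²`, `y = b/d³`). [folklore] -/
theorem padicValRat_y_of_neg {m s : ℤ} {x y : ℚ} (hE : y ^ 2 = x ^ 3 + (m * x + s) ^ 2)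
    (hx : padicValRat p x < 0) : y ≠ 0 ∧ 2 * padicValRat p y = 3 * padicValRat p x := by
  have hx0 : x ≠ 0 := by rintro rfl; simp at hx
  have hx3 : padicValRat p (x ^ 3) = 3 * padicValRat p x := by rw [padicValRat.pow]; push_cast; ring
  have hl : (m : ℚ) * x + s = 0 ∨ padicValRat p x ≤ padicValRat p ((m : ℚ) * x + s) := by
    refine le_padicValRat_add_or ?_ ?_
    · by_cases hm : (m : ℚ) = 0
      · exact Or.inl (by rw [hm, zero_mul])
      · refine Or.inr ?_
        rw [padicValRat.mul hm hx0]
        have := padicValRat_intCast_nonneg (p := p) m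
        omega
    · by_cases hs : (s : ℚ) = 0
      · exact Or.inl hs
      · have := padicValRat_intCast_nonneg (p := p) s
        exact Or.inr (by omega)
  have hl2 : ((m : ℚ) * x + s) ^ 2 = 0 ∨
      padicValRat p (x ^ 3) < padicValRat p (((m : ℚ) * x + s) ^ 2) := by
    rcases hl with h0 | hle
    · exact Or.inl (by rw [h0]; ring)
    · right; rw [hx3, padicValRat.pow]; push_cast; omega
  have hR := padicValRat_add_eq_left (p := p) (pow_ne_zero 3 hx0) hl2
  rw [← hE, hx3, padicValRat.pow] at hR
  have hy0 : y ≠ 0 := by rintro rfl; exact hR.1 (by ring)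
  refine ⟨hy0, ?_⟩
  have := hR.2
  push_cast at this
  linarith

/-- **Support law** [cite: CohenPazuki2009, Thm. 3.1 (3)]: on `y² = x³ + (mx + s)²` with `m, s ∈ ℤ`,
for every prime `p ∤ 2s` and every point with `y - (mx + s) ≠ 0`, `3 ∣ v_p(y - (mx + s))`. Cases:
`v_p(x) < 0` (then `v_p = v_p(y) = 3 v_p(x)/2 ∈ 3ℤ`); `x = 0` (then the value is `-2s`, a `p`-unit);
`x` a `p`-integer `≠ 0` (then `a = y - (mx + s)`, `b = y + (mx + s)` are `p`-integers with `ab = x³` and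
not both divisible by `p`, since `p ∣ a, b` forces `p ∣ x` and `p ∣ b - a - 2mx = 2s`). -/
theorem three_dvd_padicValRat_descent {m s : ℤ} (hps : ¬ (p : ℤ) ∣ 2 * s) {x y : ℚ}
    (hE : y ^ 2 = x ^ 3 + (m * x + s) ^ 2) (hδ : y - (m * x + s) ≠ 0) :
    (3 : ℤ) ∣ padicValRat p (y - (m * x + s)) := by
  have hp1 := (Fact.out : p.Prime).one_lt
  have h2s0 : (2 * s : ℤ) ≠ 0 := fun h => hps (h ▸ dvd_zero _)
  by_cases hx0 : x = 0
  · subst hx0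
    have hδ' : y - s ≠ 0 := by simpa using hδ
    have hy : y = -s := by
      have : (y - s) * (y + s) = 0 := by linear_combination hE
      rcases mul_eq_zero.mp this with h | h
      · exact absurd h hδ'
      · linear_combination h
    have : y - (m * 0 + s) = ((-(2 * s) : ℤ) : ℚ) := by rw [hy]; push_cast; ring
    rw [this, padicValRat.of_int, padicValInt.eq_zero_of_not_dvd (by rwa [dvd_neg])]
    simp
  by_cases hneg : padicValRat p x < 0
  · -- `x` non-integral at `p`
    obtain ⟨hy0, hvy⟩ := padicValRat_y_of_neg hE hneg
    obtain ⟨k, hk⟩ := even_padicValRat_of_neg (p := p) (a₁ := 0) (a₂ := m ^ 2) (a₃ := 0)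
      (a₄ := 2 * m * s) (a₆ := s ^ 2) (x := x) (y := y) (by push_cast; linear_combination hE) hneg
    have hl : -((m : ℚ) * x + s) = 0 ∨ padicValRat p y < padicValRat p (-((m : ℚ) * x + s)) := by
      rw [padicValRat.neg]
      have : (m : ℚ) * x + s = 0 ∨ padicValRat p x ≤ padicValRat p ((m : ℚ) * x + s) := by
        refine le_padicValRat_add_or ?_ ?_
        · by_cases hm : (m : ℚ) = 0
          · exact Or.inl (by rw [hm, zero_mul])
          · refine Or.inr ?_
            rw [padicValRat.mul hm hx0]
            have := padicValRat_intCast_nonneg (p := p) m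
            omega
        · by_cases hs : (s : ℚ) = 0
          · exact Or.inl hs
          · have := padicValRat_intCast_nonneg (p := p) s
            exact Or.inr (by omega)
      rcases this with h0 | hle
      · exact Or.inl (by rw [h0, neg_zero])
      · exact Or.inr (by omega)
    have hv := padicValRat_add_eq_left (p := p) hy0 hl
    rw [← sub_eq_add_neg] at hv
    rw [hv.2]
    exact ⟨k, by omega⟩
  · -- `x` a `p`-integer, `x ≠ 0`
    rw [not_lt] at hneg
    have hab : (y - (m * x + s)) * (y + (m * x + s)) = x ^ 3 := by linear_combination hE
    have hb0 : y + (m * x + s) ≠ 0 := fun h => by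
      rw [h, mul_zero] at hab; exact pow_ne_zero 3 hx0 hab.symm
    have hsum : padicValRat p (y - (m * x + s)) + padicValRat p (y + (m * x + s)) =
        3 * padicValRat p x := by
      rw [← padicValRat.mul hδ hb0, hab, padicValRat.pow]; push_cast; ring
    -- `mx + s`, `y` are `p`-integers
    have hl : (m : ℚ) * x + s = 0 ∨ 0 ≤ padicValRat p ((m : ℚ) * x + s) := by
      refine le_padicValRat_add_or ?_ ?_
      · by_cases hm : (m : ℚ) = 0
        · exact Or.inl (by rw [hm, zero_mul])
        · refine Or.inr ?_
          rw [padicValRat.mul hm hx0]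
          have := padicValRat_intCast_nonneg (p := p) m
          omega
      · exact Or.inr (padicValRat_intCast_nonneg (p := p) s)
    have hy : y = 0 ∨ 0 ≤ padicValRat p y := by
      by_cases hy0 : y = 0
      · exact Or.inl hy0
      right
      have hl2 : ((m : ℚ) * x + s) ^ 2 = 0 ∨ 0 ≤ padicValRat p (((m : ℚ) * x + s) ^ 2) := by
        rcases hl with h0 | hle
        · exact Or.inl (by rw [h0]; ring)
        · right; rw [padicValRat.pow]; push_cast; omega
      have hR := le_padicValRat_add_or (p := p) (c := 0) (a := x ^ 3)
        (Or.inr (by rw [padicValRat.pow]; push_cast; omega)) hl2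
      rw [← hE] at hR
      rcases hR with h0 | hle
      · exact absurd (pow_eq_zero_iff two_ne_zero |>.mp h0) hy0
      · rw [padicValRat.pow] at hle; push_cast at hle; omega
    have ha_nn : 0 ≤ padicValRat p (y - (m * x + s)) := by
      have := le_padicValRat_add_or (p := p) (c := 0) (a := y) (b := -((m : ℚ) * x + s)) hy
        (by rw [neg_eq_zero, padicValRat.neg]; exact hl)
      rw [← sub_eq_add_neg] at this
      exact this.resolve_left hδ
    have hb_nn : 0 ≤ padicValRat p (y + (m * x + s)) :=
      (le_padicValRat_add_or (p := p) (c := 0) (a := y) (b := (m : ℚ) * x + s) hy hl).resolve_left hb0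
    -- not both divisible by `p`
    have key : padicValRat p (y - (m * x + s)) = 0 ∨ padicValRat p (y + (m * x + s)) = 0 := by
      rcases eq_or_ne (padicValRat p (y - (m * x + s))) 0 with ha0 | ha0
      · exact Or.inl ha0
      rcases eq_or_ne (padicValRat p (y + (m * x + s))) 0 with hb0' | hb0'
      · exact Or.inr hb0'
      exfalso
      have ha1 : 1 ≤ padicValRat p (y - (m * x + s)) := by omega
      have hb1 : 1 ≤ padicValRat p (y + (m * x + s)) := by omega
      have hx1 : 1 ≤ padicValRat p x := by omega
      have h2mx : -(2 * (m : ℚ) * x) = 0 ∨ 1 ≤ padicValRat p (-(2 * (m : ℚ) * x)) := by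
        by_cases hm : (m : ℚ) = 0
        · exact Or.inl (by rw [hm]; ring)
        · right
          rw [padicValRat.neg, padicValRat.mul (mul_ne_zero two_ne_zero hm) hx0,
            padicValRat.mul two_ne_zero hm]
          have h2 := padicValRat_intCast_nonneg (p := p) 2
          have hmv := padicValRat_intCast_nonneg (p := p) m
          push_cast at h2
          omega
      have hv2s := le_padicValRat_add_or (p := p) (c := 1)
        (le_padicValRat_add_or (p := p) (c := 1) (a := y + ((m : ℚ) * x + s))
          (b := -(y - ((m : ℚ) * x + s))) (Or.inr hb1) (Or.inr (by rw [padicValRat.neg]; exact ha1)))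
        h2mx
      have h2s : y + ((m : ℚ) * x + s) + -(y - ((m : ℚ) * x + s)) + -(2 * (m : ℚ) * x) =
          ((2 * s : ℤ) : ℚ) := by push_cast; ring
      rw [h2s, padicValRat.of_int] at hv2s
      rcases hv2s with h0 | hle
      · exact h2s0 (by exact_mod_cast h0)
      · have hd : (p : ℤ) ^ 1 ∣ 2 * s :=
          (padicValInt_dvd_iff (p := p) 1 (2 * s)).mpr (Or.inr (by exact_mod_cast hle))
        exact hps (by rwa [pow_one] at hd)
    rcases key with h0 | h0
    · rw [h0]; exact dvd_zero 3
    · exact ⟨padicValRat p x, by omega⟩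

end Valuation

/-! ### The finite candidate set `S₁ ⊇ Im α` -/

/-- The descent value at a point: non-zero, and a `p`-unit up to cubes at every prime `p ∤ 2s`.
[cite: CohenPazuki2009, Thm. 3.1 (3)] -/
theorem descent_value_ne_zero_and_dvd {W W' : WeierstrassCurve ℚ} {m s : ℤ}
    (h : IsVeluThreePair (m : ℚ) (s : ℚ) W W') {x y : ℚ} (hP : W.toAffine.Nonsingular x y) :
    (if y = m * x + s then (2 * (s : ℚ)) ^ 2 else y - (m * x + s)) ≠ 0 ∧
      ∀ p : ℕ, p.Prime → ¬ p ∣ (2 * s).natAbs →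
        (3 : ℤ) ∣ padicValRat p (if y = m * x + s then (2 * (s : ℚ)) ^ 2 else y - (m * x + s)) := by
  have hs0 : (s : ℚ) ≠ 0 := h.s_ne
  have hE : y ^ 2 = x ^ 3 + (m * x + s) ^ 2 := by
    have := (h.equation_iff x y).mp hP.left; linear_combination this
  by_cases hy : y = m * x + s
  · rw [if_pos hy]
    refine ⟨pow_ne_zero 2 (mul_ne_zero two_ne_zero hs0), fun p hp hpN => ?_⟩
    haveI : Fact p.Prime := ⟨hp⟩
    have hps : ¬ (p : ℤ) ∣ 2 * s := fun hd => hpN (by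
      have := Int.natAbs_dvd_natAbs.mpr hd; simpa using this)
    have : (2 * (s : ℚ)) ^ 2 = (((2 * s) ^ 2 : ℤ) : ℚ) := by push_cast; ring
    rw [this, padicValRat.of_int, padicValInt.eq_zero_of_not_dvd]
    · simp
    · rw [pow_two]
      exact fun hd => hps ((Nat.prime_iff_prime_int.mp hp).dvd_or_dvd hd |>.elim id id)
  · rw [if_neg hy]
    refine ⟨sub_ne_zero.mpr hy, fun p hp hpN => ?_⟩
    haveI : Fact p.Prime := ⟨hp⟩
    have hps : ¬ (p : ℤ) ∣ 2 * s := fun hd => hpN (by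
      have := Int.natAbs_dvd_natAbs.mpr hd; simpa using this)
    exact three_dvd_padicValRat_descent hps hE (sub_ne_zero.mpr hy)

/-- **`Im α ⊆ S₁ = {[∏_{p ∣ 2s} p^{e_p}] : 0 ≤ e_p ≤ 2}`**: for any additive `κ` on `E_{m,s}(ℚ)`
(`m, s ∈ ℤ`) with the `3`-descent values, every `κ(P)` is the class of a product of the primes of `2s`
with exponents `< 3`. This is the finite set fed to `ThreeIso.three_pow_mordellWeilRank_succ_le_of_zsmul`
(before the local conditions). [cite: CohenPazuki2009, Thm. 3.1 (3); Cohen2007NumberTheoryI, §8.4.4] -/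
theorem descent_value_mem {W W' : WeierstrassCurve ℚ} {m s : ℤ}
    (h : IsVeluThreePair (m : ℚ) (s : ℚ) W W')
    (κ : W.toAffine.Point →+ Additive (CubeUnits ℚ))
    (hκ : ∀ (x y : ℚ) (hP : W.toAffine.Nonsingular x y), κ (.some x y hP) =
      Additive.ofMul (cubeClass (if y = m * x + s then (2 * (s : ℚ)) ^ 2 else y - (m * x + s))))
    (P : W.toAffine.Point) :
    ∃ e : ℕ → ℕ, (∀ p, e p < 3) ∧
      κ P = Additive.ofMul (cubeClass (∏ p ∈ (2 * s).natAbs.primeFactors, (p : ℚ) ^ e p)) := by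
  have hN : (2 * s).natAbs ≠ 0 := Int.natAbs_ne_zero.mpr (mul_ne_zero two_ne_zero (by
    have := h.s_ne; exact_mod_cast this))
  rcases P with _ | ⟨x, y, hP⟩
  · refine ⟨fun _ => 0, fun _ => by norm_num, ?_⟩
    simp only [pow_zero, Finset.prod_const_one, cubeClass_one]
    rw [← Affine.Point.zero_def, map_zero]
    rfl
  · obtain ⟨hne, hdvd⟩ := descent_value_ne_zero_and_dvd h hP
    obtain ⟨e, he, hcl⟩ := cubeClass_eq_prod_primeFactors hne hN hdvd
    exact ⟨e, he, by rw [hκ, hcl]⟩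

end Summit.BirchSwinnertonDyer.BirchSwinnertonDyer.Rank2Observatory.ThreeIso
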